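import Mathlib.LinearAlgebra.Dual.Lemmas
import Mathlib.LinearAlgebra.FiniteDimensional.Lemmas

/-!
# Route CodingVolumeShifts — crux `CodingVolume` (stmt-PneNP-19454): linear-algebra toolkit for
# the linear rungs

Bookkeeping over a field `K` for the dual space `Module.Dual K (ι → K)` of the coordinate space on a
finite index type `ι` (the space in which the labels of an `𝔽₂`-linear one-shot network code live),
used by the volume bounds for LINEAR codes (`CodingVolumeShiftsCodingVolumeLinear*`):

* the coordinate functionals `LinearMap.proj i` span the dual and are linearly independent
  (`codingVolume_dual_eq_sum`, `codingVolume_proj_linearIndependent`,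
  `codingVolume_finrank_span_proj`), membership in a coordinate span
  (`codingVolume_mem_span_proj_iff`), disjointly supported spans meet in `⊥`;
* COORDINATE-KILLING maps, specified only by their action on the coordinate functionals
  (`f (proj i) = 0` for `i ∈ C`, `= proj i` otherwise; existence `codingVolume_exists_kill`,
  evaluation, action on coordinate spans, composition) — no definitions are introduced, the maps are
  hypotheses;
* `finrank` arithmetic: rank–nullity for the image of a subspace
  (`codingVolume_finrank_map_add_finrank_inf_ker`), its monotone "quotient" form
  (`codingVolume_finrank_map_quotient_le`), sub-additivity over finite suprema, additivity for
  disjointly supported subspaces.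

All statements are elementary linear algebra ([folklore]); no definitions.
-/

set_option linter.dupNamespace false -- `Summit.PneNP.PneNP.…`: summit = sub-problem name (D-0017)

namespace Summit.PneNP.PneNP.Theorems

open Module Submodule

section LinAlg

variable {K : Type*} [Field K] {ι : Type*} [Fintype ι] [DecidableEq ι]

/-- Every functional on the coordinate space is the combination of the coordinate functionals with
its values on the standard basis vectors as coefficients. [folklore] -/
theorem codingVolume_dual_eq_sum (φ : Module.Dual K (ι → K)) :
    φ = ∑ i, φ (Pi.single i 1) • (LinearMap.proj i : Module.Dual K (ι → K)) := by
  apply LinearMap.ext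
  intro x
  conv_lhs => rw [← Finset.univ_sum_single x]
  simp only [map_sum, LinearMap.coe_sum, Finset.sum_apply, LinearMap.smul_apply,
    LinearMap.coe_proj, Function.eval, smul_eq_mul]
  refine Finset.sum_congr rfl fun i _ => ?_
  have : Pi.single (M := fun _ => K) i (x i) = x i • Pi.single i 1 := by
    ext j
    rcases eq_or_ne j i with rfl | h
    · simp
    · simp [Pi.single_eq_of_ne h]
  rw [this, map_smul, smul_eq_mul, mul_comm]

/-- The coordinate functionals span the dual of the coordinate space. [folklore] -/
theorem codingVolume_span_proj_eq_top :
    span K (Set.range fun i : ι => (LinearMap.proj i : Module.Dual K (ι → K))) = ⊤ := by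
  rw [eq_top_iff]
  intro φ _
  rw [codingVolume_dual_eq_sum φ]
  exact sum_mem fun i _ => smul_mem _ _ (subset_span ⟨i, rfl⟩)

/-- Two linear maps out of the dual that agree on the coordinate functionals are equal.
[folklore] -/
theorem codingVolume_dual_hom_ext {V : Type*} [AddCommGroup V] [Module K V]
    {f g : Module.Dual K (ι → K) →ₗ[K] V}
    (h : ∀ i, f (LinearMap.proj i) = g (LinearMap.proj i)) : f = g := by
  apply LinearMap.ext
  intro φ
  rw [codingVolume_dual_eq_sum φ, map_sum, map_sum]
  exact Finset.sum_congr rfl fun i _ => by rw [map_smul, map_smul, h i]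

omit [Fintype ι] in
/-- The coordinate functionals are linearly independent. [folklore] -/
theorem codingVolume_proj_linearIndependent :
    LinearIndependent K fun i : ι => (LinearMap.proj i : Module.Dual K (ι → K)) := by
  rw [linearIndependent_iff']
  intro s c hc i hi
  have h := congrArg (fun φ : Module.Dual K (ι → K) => φ (Pi.single i 1)) hc
  simp only [LinearMap.coe_sum, Finset.sum_apply, LinearMap.smul_apply, LinearMap.coe_proj,
    Function.eval, smul_eq_mul, LinearMap.zero_apply] at h
  rw [Finset.sum_eq_single i (fun j _ hji => by rw [Pi.single_eq_of_ne hji, mul_zero])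
    (fun h' => absurd hi h')] at h
  simpa using h

omit [Fintype ι] in
/-- A coordinate span has dimension the number of coordinates. [folklore] -/
theorem codingVolume_finrank_span_proj (C : Finset ι) :
    finrank K (span K ((fun i : ι => (LinearMap.proj i : Module.Dual K (ι → K))) '' ↑C)) =
      C.card := by
  rw [Set.image_eq_range, finrank_span_eq_card]
  · simp
  · exact (codingVolume_proj_linearIndependent (K := K)).comp _ Subtype.val_injective

/-- Membership in a coordinate span: a functional lies in the span of the coordinate functionals
`proj i`, `i ∈ C`, iff it vanishes on the standard basis vectors outside `C`. [folklore] -/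
theorem codingVolume_mem_span_proj_iff (C : Set ι) (φ : Module.Dual K (ι → K)) :
    φ ∈ span K ((fun i : ι => (LinearMap.proj i : Module.Dual K (ι → K))) '' C) ↔
      ∀ i, i ∉ C → φ (Pi.single i 1) = 0 := by
  classical
  constructor
  · intro hφ i hi
    induction hφ using span_induction with
    | mem x hx =>
      obtain ⟨j, hj, rfl⟩ := hx
      have hji : j ≠ i := fun h => hi (h ▸ hj)
      simp [Pi.single_eq_of_ne' hji.symm]
    | zero => simp
    | add x y _ _ hx hy => simp [hx, hy]
    | smul a x _ hx => simp [hx]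
  · intro h
    rw [codingVolume_dual_eq_sum φ]
    refine sum_mem fun i _ => ?_
    by_cases hi : i ∈ C
    · exact smul_mem _ _ (subset_span ⟨i, hi, rfl⟩)
    · rw [h i hi, zero_smul]
      exact zero_mem _

/-- Coordinate spans on disjoint coordinate sets meet only in `0`. [folklore] -/
theorem codingVolume_span_proj_inf_eq_bot {B B' : Set ι} (hBB : Disjoint B B') :
    span K ((fun i : ι => (LinearMap.proj i : Module.Dual K (ι → K))) '' B) ⊓
      span K ((fun i : ι => (LinearMap.proj i : Module.Dual K (ι → K))) '' B') = ⊥ := by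
  rw [eq_bot_iff]
  intro φ hφ
  rw [mem_inf, codingVolume_mem_span_proj_iff, codingVolume_mem_span_proj_iff] at hφ
  rw [mem_bot, codingVolume_dual_eq_sum φ]
  refine Finset.sum_eq_zero fun i _ => ?_
  by_cases hi : i ∈ B
  · rw [hφ.2 i (Disjoint.notMem_of_mem_left hBB hi), zero_smul]
  · rw [hφ.1 i hi, zero_smul]

/-! ### Coordinate-killing maps (specified by their action on the coordinate functionals) -/

omit [Fintype ι] [DecidableEq ι] in
/-- A coordinate-killing map exists for every coordinate set `C`: a linear endomorphism of the dual
sending `proj i` to `0` for `i ∈ C` and fixing it otherwise (precomposition with the projection that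
zeroes the coordinates in `C`). [folklore] -/
theorem codingVolume_exists_kill (C : Set ι) [DecidablePred (· ∈ C)] :
    ∃ f : Module.Dual K (ι → K) →ₗ[K] Module.Dual K (ι → K),
      ∀ i, f (LinearMap.proj i) = if i ∈ C then 0 else LinearMap.proj i := by
  let P : (ι → K) →ₗ[K] (ι → K) :=
    LinearMap.pi fun i => if i ∈ C then (0 : (ι → K) →ₗ[K] K) else LinearMap.proj i
  refine ⟨P.dualMap, fun i => ?_⟩
  apply LinearMap.ext
  intro x
  rw [LinearMap.dualMap_apply]
  by_cases hi : i ∈ C <;> simp [P, hi]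

/-- Evaluation of a coordinate-killing map: `(f φ)` takes on the basis vector `e_j` the value `0`
if `j ∈ C` and `φ e_j` otherwise. [folklore] -/
theorem codingVolume_kill_apply_single {C : Set ι} [DecidablePred (· ∈ C)]
    {f : Module.Dual K (ι → K) →ₗ[K] Module.Dual K (ι → K)}
    (hf : ∀ i, f (LinearMap.proj i) = if i ∈ C then 0 else LinearMap.proj i)
    (φ : Module.Dual K (ι → K)) (j : ι) :
    f φ (Pi.single j 1) = if j ∈ C then 0 else φ (Pi.single j 1) := by
  conv_lhs => rw [codingVolume_dual_eq_sum φ]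
  rw [map_sum, LinearMap.coe_sum, Finset.sum_apply]
  simp_rw [map_smul, hf]
  rw [Finset.sum_eq_single j]
  · by_cases hj : j ∈ C <;> simp [hj]
  · intro i _ hij
    by_cases hi : i ∈ C <;> simp [hi, Pi.single_eq_of_ne' hij.symm]
  · intro h; exact absurd (Finset.mem_univ j) h

/-- A coordinate-killing map sends the coordinate span of `B` into the coordinate span of `B \ C`.
[folklore] -/
theorem codingVolume_kill_map_span_le {C : Set ι} [DecidablePred (· ∈ C)]
    {f : Module.Dual K (ι → K) →ₗ[K] Module.Dual K (ι → K)}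
    (hf : ∀ i, f (LinearMap.proj i) = if i ∈ C then 0 else LinearMap.proj i) (B : Set ι) :
    (span K ((fun i : ι => (LinearMap.proj i : Module.Dual K (ι → K))) '' B)).map f ≤
      span K ((fun i : ι => (LinearMap.proj i : Module.Dual K (ι → K))) '' (B \ C)) := by
  rw [map_le_iff_le_comap]
  intro φ hφ
  rw [mem_comap, codingVolume_mem_span_proj_iff]
  rw [codingVolume_mem_span_proj_iff] at hφ
  intro i hi
  rw [codingVolume_kill_apply_single hf]
  by_cases hiC : i ∈ C
  · simp [hiC]
  · simp only [hiC, if_false]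
    exact hφ i (fun hiB => hi ⟨hiB, hiC⟩)

/-- A coordinate-killing map fixes functionals supported away from the killed set. [folklore] -/
theorem codingVolume_kill_eq_self_of_mem_span {C : Set ι} [DecidablePred (· ∈ C)]
    {f : Module.Dual K (ι → K) →ₗ[K] Module.Dual K (ι → K)}
    (hf : ∀ i, f (LinearMap.proj i) = if i ∈ C then 0 else LinearMap.proj i) {B : Set ι}
    (hBC : Disjoint B C) {φ : Module.Dual K (ι → K)}
    (hφ : φ ∈ span K ((fun i : ι => (LinearMap.proj i : Module.Dual K (ι → K))) '' B)) :
    f φ = φ := by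
  rw [codingVolume_mem_span_proj_iff] at hφ
  have h1 := codingVolume_dual_eq_sum (f φ)
  have h2 := codingVolume_dual_eq_sum φ
  rw [h1]
  conv_rhs => rw [h2]
  refine Finset.sum_congr rfl fun i _ => ?_
  rw [codingVolume_kill_apply_single hf]
  by_cases hiC : i ∈ C
  · rw [if_pos hiC, hφ i (Disjoint.notMem_of_mem_right hBC hiC)]
  · rw [if_neg hiC]

/-- A coordinate-killing map kills functionals supported inside the killed set. [folklore] -/
theorem codingVolume_kill_eq_zero_of_mem_span {C : Set ι} [DecidablePred (· ∈ C)]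
    {f : Module.Dual K (ι → K) →ₗ[K] Module.Dual K (ι → K)}
    (hf : ∀ i, f (LinearMap.proj i) = if i ∈ C then 0 else LinearMap.proj i) {B : Set ι}
    (hBC : B ⊆ C) {φ : Module.Dual K (ι → K)}
    (hφ : φ ∈ span K ((fun i : ι => (LinearMap.proj i : Module.Dual K (ι → K))) '' B)) :
    f φ = 0 := by
  rw [codingVolume_mem_span_proj_iff] at hφ
  rw [codingVolume_dual_eq_sum (f φ)]
  refine Finset.sum_eq_zero fun i _ => ?_
  rw [codingVolume_kill_apply_single hf]
  by_cases hiC : i ∈ C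
  · rw [if_pos hiC, zero_smul]
  · rw [if_neg hiC, hφ i (fun hiB => hiC (hBC hiB)), zero_smul]

omit [Fintype ι] [DecidableEq ι] in
/-- Composition of coordinate-killing maps kills the union. [folklore] -/
theorem codingVolume_kill_comp {C C' : Set ι} [DecidablePred (· ∈ C)] [DecidablePred (· ∈ C')]
    [DecidablePred (· ∈ C ∪ C')]
    {f g : Module.Dual K (ι → K) →ₗ[K] Module.Dual K (ι → K)}
    (hf : ∀ i, f (LinearMap.proj i) = if i ∈ C then 0 else LinearMap.proj i)
    (hg : ∀ i, g (LinearMap.proj i) = if i ∈ C' then 0 else LinearMap.proj i) (i : ι) :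
    (f.comp g) (LinearMap.proj i) = if i ∈ C ∪ C' then 0 else LinearMap.proj i := by
  rw [LinearMap.comp_apply, hg]
  by_cases hi' : i ∈ C'
  · simp [hi']
  · by_cases hi : i ∈ C <;> simp [hi, hi', hf]

/-! ### `finrank` arithmetic -/

/-- Rank–nullity for the image of a subspace: `dim f(X) + dim (X ∩ ker f) = dim X`. [folklore] -/
theorem codingVolume_finrank_map_add_finrank_inf_ker {V W : Type*} [AddCommGroup V] [Module K V]
    [AddCommGroup W] [Module K W] [FiniteDimensional K V] (f : V →ₗ[K] W) (X : Submodule K V) :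
    finrank K (X.map f) + finrank K (X ⊓ LinearMap.ker f : Submodule K V) = finrank K X := by
  have h := LinearMap.finrank_range_add_finrank_ker (f.domRestrict X)
  have hr : LinearMap.range (f.domRestrict X) = X.map f := by
    rw [LinearMap.domRestrict, LinearMap.range_comp, Submodule.range_subtype]
  have hk : finrank K (LinearMap.ker (f.domRestrict X)) =
      finrank K (X ⊓ LinearMap.ker f : Submodule K V) := by
    have hker : LinearMap.ker (f.domRestrict X) = (X ⊓ LinearMap.ker f).comap X.subtype := by
      ext ⟨x, hx⟩
      simp [LinearMap.mem_ker]
    rw [hker]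
    exact (Submodule.comapSubtypeEquivOfLe (inf_le_left : X ⊓ LinearMap.ker f ≤ X)).finrank_eq
  rw [← hr, ← hk, h]

/-- If `Y ≤ X` is killed by `f`, then `dim f(X) + dim Y ≤ dim X`. [folklore] -/
theorem codingVolume_finrank_map_add_le {V W : Type*} [AddCommGroup V] [Module K V]
    [AddCommGroup W] [Module K W] [FiniteDimensional K V] (f : V →ₗ[K] W) {X Y : Submodule K V}
    (hYX : Y ≤ X) (hYf : Y ≤ LinearMap.ker f) :
    finrank K (X.map f) + finrank K Y ≤ finrank K X := by
  rw [← codingVolume_finrank_map_add_finrank_inf_ker f X]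
  exact Nat.add_le_add_left (Submodule.finrank_mono (le_inf hYX hYf)) _

/-- Monotone "quotient" form of rank–nullity: for `Y ≤ Z`,
`dim f(Z) + dim Y ≤ dim Z + dim f(Y)`, i.e. `dim Z − dim Y ≥ dim f(Z) − dim f(Y)`. [folklore] -/
theorem codingVolume_finrank_map_quotient_le {V W : Type*} [AddCommGroup V] [Module K V]
    [AddCommGroup W] [Module K W] [FiniteDimensional K V] (f : V →ₗ[K] W) {Y Z : Submodule K V}
    (hYZ : Y ≤ Z) :
    finrank K (Z.map f) + finrank K Y ≤ finrank K Z + finrank K (Y.map f) := by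
  have hZ := codingVolume_finrank_map_add_finrank_inf_ker f Z
  have hY := codingVolume_finrank_map_add_finrank_inf_ker f Y
  have hmono : finrank K (Y ⊓ LinearMap.ker f : Submodule K V) ≤
      finrank K (Z ⊓ LinearMap.ker f : Submodule K V) :=
    Submodule.finrank_mono (inf_le_inf_right _ hYZ)
  omega

/-- Sub-additivity of dimension over a finite supremum. [folklore] -/
theorem codingVolume_finrank_biSup_le_sum {V : Type*} [AddCommGroup V] [Module K V]
    [FiniteDimensional K V] {α : Type*} (s : Finset α) (U : α → Submodule K V) :
    finrank K (⨆ a ∈ s, U a : Submodule K V) ≤ ∑ a ∈ s, finrank K (U a) := by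
  classical
  induction s using Finset.induction_on with
  | empty => simp
  | insert a s ha ih =>
    rw [Finset.iSup_insert, Finset.sum_insert ha]
    exact (Submodule.finrank_add_le_finrank_add_finrank _ _).trans (Nat.add_le_add_left ih _)

/-- Dimension is additive on subspaces supported on disjoint coordinate sets. [folklore] -/
theorem codingVolume_finrank_sup_of_disjoint_support {B B' : Set ι} (hBB : Disjoint B B')
    {U W : Submodule K (Module.Dual K (ι → K))}
    (hU : U ≤ span K ((fun i : ι => (LinearMap.proj i : Module.Dual K (ι → K))) '' B))
    (hW : W ≤ span K ((fun i : ι => (LinearMap.proj i : Module.Dual K (ι → K))) '' B')) :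
    finrank K (U ⊔ W : Submodule K _) = finrank K U + finrank K W := by
  have h := Submodule.finrank_sup_add_finrank_inf_eq U W
  have hbot : U ⊓ W = ⊥ := by
    rw [eq_bot_iff, ← codingVolume_span_proj_inf_eq_bot (K := K) hBB]
    exact inf_le_inf hU hW
  rw [hbot, finrank_bot, add_zero] at h
  exact h

end LinAlg

end Summit.PneNP.PneNP.Theorems
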